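import Literature.Analysis.FluidPDE.AxisymmetricTypeIAxis
import Literature.Analysis.FluidPDE.SereginEpsilonRegularityHolds
import Literature.Analysis.FluidPDE.AxisymmetricTypeIInfinityRRS
import Literature.Analysis.FluidPDE.KNSSTypeIRateLiouvilleHolds
import Literature.Analysis.FluidPDE.SereginSverakScaledEnergyHolds
import HarnessLib

/-!
# `axisymmetric_typeI_bounded` and `knss_no_axisymmetric_typeI` from the Seregin–Šverák barrier alone

Analysis/FluidPDE proofs-layer file (theorems only: no definitions, no named facts) on the
decomposition path of the named target
`Literature.Analysis.FluidPDE.axisymmetric_typeI_bounded` (`KNSSTypeII.lean`: a classical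
solution of Navier–Stokes on `ℝ³ × [0, T)`, Leray–Hopf on `[0, T)`, bounded on `[0, T'] × ℝ³` for
every `T' < T`, axisymmetric, blowing up at most at the Type I rate at `T`, is bounded on
`[0, T) × ℝ³` — the finite-energy global reading of Seregin–Šverák 2009, Thm. 3.1 = Thm. 1.1,
arXiv:0804.1803 pp. 4 and 19; not KNSS 2009, Thm. 6.2, which needs the decay (assumption2),
arXiv:0709.3599 p. 12: "the statement fails, for trivial reasons, if we drop assumption (2)").

The accepted glue `axisymmetric_typeI_bounded_of_local` (`AxisymmetricTypeIBounded.lean`) reduces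
the target to three local inputs. Two of them are by now THEOREMS of the tree:
`axisymmetric_typeI_boundedNearTop_offAxis_holds` (`SereginEpsilonRegularityHolds.lean`: off-axis
points are regular — "It is well-known due to Caffarelli–Kohn–Nirenberg that if `z = (x, t)` is
singular … then there must be `x' = 0`", Seregin–Šverák 2009, arXiv p. 19 — through Seregin 2014,
Ch. 6, Thm. 1.4 and Robinson–Rodrigo–Sadowski 2016, Lemma 15.12, both discharged) and
`typeI_boundedNearTop_infinity_holds` (`AxisymmetricTypeIInfinityRRS.lean`: the one-scale
ε-regularity criterion on the tails, Lemarié-Rieusset 2016, Thm. 14.4, discharged). The third,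
`axisymmetric_typeI_boundedNearTop_axis`, is the accepted theorem
`axisymmetric_typeI_boundedNearTop_axis_of_barrier` applied to the catalogued barrier
`Literature.Barriers.NavierStokesRegularity.AxisymmetricTypeIExclusion` (Seregin–Šverák 2009,
Thm. 3.1), which is the ONLY undischarged input left. This file records that state:

* `axisymmetric_typeI_bounded_of_barrier : AxisymmetricTypeIExclusion → axisymmetric_typeI_bounded`;
* `knss_no_axisymmetric_typeI_of_barrier : AxisymmetricTypeIExclusion → knss_no_axisymmetric_typeI`
  (the other two parts of `knss_no_axisymmetric_typeI_of_parts` being the theorems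
  `KNSS2009_regularity_bound_C_over_r_holds` and `hasSmoothExtensionPast_of_bounded_holds`);
* the same two statements over the barrier's own undischarged leaves
  (`axisymmetricTypeIExclusion_of_leaves` with `ScaledEnergyBound_holds` and
  `KNSS2009_liouville_bound_C_over_r_holds`): the off-axis bound (as14) of the proof of
  Seregin–Šverák's Prop. 3.7 (`SereginSverak2009.OffAxisBound`, = Seregin–Zajaczkowski 2007,
  Prop. 4.1 rescaled) and the Type I blow-up alternative of their §4
  (`SereginSverak2009.BlowupAlternativeTypeI`).

Hence the discharge `axisymmetric_typeI_bounded_holds` is the one-line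
`axisymmetric_typeI_bounded_of_barrier AxisymmetricTypeIExclusion_holds` once the barrier is
discharged; nothing else is missing. Nothing is asserted here.

## References

* G. Seregin, V. Šverák, *On Type I singularities of the local axi-symmetric solutions of the
  Navier–Stokes equations*, Comm. PDE 34 (2009) 171–201 = arXiv:0804.1803: Thm. 1.1 (p. 4),
  Thm. 3.1 and the remark on off-axis singular points (p. 19), Lemma 3.5, Prop. 3.7, §4.
  [SereginSverak2009]
* G. Koch, N. Nadirashvili, G. Seregin, V. Šverák, *Liouville theorems for the Navier–Stokes
  equations and applications*, Acta Math. 203 (2009) 83–105 = arXiv:0709.3599, §6, Thms. 6.1–6.2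
  and the remark after Thm. 6.2 (pp. 11–12). [KochNadirashviliSereginSverak2009]
-/

noncomputable section

namespace Literature.Analysis.FluidPDE

open Literature.Barriers.NavierStokesRegularity SereginSverak2009

/-- **`axisymmetric_typeI_bounded` from the Seregin–Šverák barrier alone.** The three local
inputs of the accepted glue `axisymmetric_typeI_bounded_of_local`: axis points from the barrier
(`axisymmetric_typeI_boundedNearTop_axis_of_barrier`), off-axis points and spatial infinity from
the discharged `axisymmetric_typeI_boundedNearTop_offAxis_holds` and
`typeI_boundedNearTop_infinity_holds`. [cite: SereginSverak2009, Thm 3.1 (= Thm 1.1, arXiv pp. 4, 19)] -/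
theorem axisymmetric_typeI_bounded_of_barrier (hSS : AxisymmetricTypeIExclusion) :
    axisymmetric_typeI_bounded :=
  axisymmetric_typeI_bounded_of_local (axisymmetric_typeI_boundedNearTop_axis_of_barrier hSS)
    axisymmetric_typeI_boundedNearTop_offAxis_holds typeI_boundedNearTop_infinity_holds

/-- **`knss_no_axisymmetric_typeI` from the Seregin–Šverák barrier alone**: the accepted assembly
`knss_no_axisymmetric_typeI_of_parts` fed with the discharged KNSS Thm. 6.1
(`KNSS2009_regularity_bound_C_over_r_holds`), the discharged continuation of bounded Leray–Hopf
solutions (`hasSmoothExtensionPast_of_bounded_holds`) and `axisymmetric_typeI_bounded_of_barrier`.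
[cite: KochNadirashviliSereginSverak2009, Thms 6.1–6.2 (§6, arXiv pp. 11–13)] -/
theorem knss_no_axisymmetric_typeI_of_barrier (hSS : AxisymmetricTypeIExclusion) :
    knss_no_axisymmetric_typeI :=
  knss_no_axisymmetric_typeI_of_parts KNSS2009_regularity_bound_C_over_r_holds
    hasSmoothExtensionPast_of_bounded_holds (axisymmetric_typeI_bounded_of_barrier hSS)

/-- **`axisymmetric_typeI_bounded` from the two undischarged leaves of the barrier**: the off-axis
bound (as14) of the proof of Seregin–Šverák's Prop. 3.7 (`OffAxisBound`) and the Type I blow-up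
alternative of their §4 (`BlowupAlternativeTypeI`); Lemma 3.5 (`ScaledEnergyBound_holds`) and
KNSS 2009, Thm. 5.3 (`KNSS2009_liouville_bound_C_over_r_holds`) are theorems, and
`axisymmetricTypeIExclusion_of_leaves` assembles the barrier.
[cite: SereginSverak2009, Thm 3.1 with Lemma 3.5, Prop 3.7 and §4 (arXiv pp. 19–28)] -/
theorem axisymmetric_typeI_bounded_of_ss_leaves (hoff : OffAxisBound)
    (h4 : BlowupAlternativeTypeI) : axisymmetric_typeI_bounded :=
  axisymmetric_typeI_bounded_of_barrier
    (axisymmetricTypeIExclusion_of_leaves ScaledEnergyBound_holds hoff h4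
      KNSS2009_liouville_bound_C_over_r_holds)

/-- **`knss_no_axisymmetric_typeI` from the same two leaves.**
[cite: KochNadirashviliSereginSverak2009, Thms 6.1–6.2 (§6, arXiv pp. 11–13)] -/
theorem knss_no_axisymmetric_typeI_of_ss_leaves (hoff : OffAxisBound)
    (h4 : BlowupAlternativeTypeI) : knss_no_axisymmetric_typeI :=
  knss_no_axisymmetric_typeI_of_barrier
    (axisymmetricTypeIExclusion_of_leaves ScaledEnergyBound_holds hoff h4
      KNSS2009_liouville_bound_C_over_r_holds)

end Literature.Analysis.FluidPDE

end
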